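import Literature.Geometry.DiscreteGeometry.LayerShellPatterns
import Summits.Ventures.Crystal3D.Theorems.StickyWulffConstantPolycrystalWulffBoundTwinSectionShift
import Summits.Ventures.Crystal3D.Theorems.StickyWulffConstantPolycrystalWulffBoundRungInclinedLocal
import Summits.Ventures.Crystal3D.Theorems.StickyWulffConstantPolycrystalWulffBoundTwinSectionShiftCubicTwin

/-!
# `PolycrystalWulffBound`, line `PolyDensity`: **`TwinSectionShift (1/√6)` is a theorem** — the
# inclined-lamellar twin rung `rung_inclinedLamellar_twin` holds UNCONDITIONALLY at the crux's wall charge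
# `½·sin∠(n,m)` (crux `stmt-Ventures-19482`)

Route `StickyWulffConstant` of the venture `Summits/Ventures/Crystal3D`, second prover lane (poly-p2,
gen 9).  Poly-p2 g8 reduced «P for inclined lamellar twin textures» to ONE named computational
hypothesis, `TwinSectionShift c` (`…TwinSectionShift.lean`): for every co-axial frame pair `Ax m A B`,
every unit normal `n` and every level `t`,
`|W(B) ∩ {⟪y,n⟫ < t}| ≤ |W(A) ∩ {⟪y,n⟫ < t + c·√(1 − ⟪n,m⟫²)}|`, numerically sharp at `c = 1/√6`.
This file PROVES it for `c = 1/√6` (hence for every `c ≥ 1/√6`, in particular the crux's `½`), with no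
numerics, by transporting the cubic-frame theorem `fccWulffBody_twin_cdf_le`
(`…TwinSectionShiftCubicTwin.lean`: central symmetry + a `{1 -1 0}` mirror + the chord flip along a
`⟨112⟩` zone whose cap reflects into the truncated octahedron) to the crux's bodies:
* `exists_cubicFrame_unitShell_eq` — an explicit cubic frame `L` (Hales's close-packing frame of
  `LayerShellPatterns.lean`) with `{w ∈ Λ₀ : ‖w‖ = 1} = L(fccKissingPattern)` AND `L(1,1,1) ∥ e₂`
  (the stacking axis), so that `W(A) = (M ∘ L)(W_cubic)` with the twin axis `m` pulled back to
  `ℝ·(1,1,1)` (`exists_frame_cruxWulffBody`, `cruxWulffBody_eq_or_eq_reflection_image`);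
* `map_reflection_orthogonal`, `reflection_orthogonal_smul` — conjugating mirrors by isometries;
* `cruxWulffBody_twin_cdf_le` — the section shift in the crux's vocabulary;
* **`twinSectionShift_inv_sqrt_six : TwinSectionShift (1/√6)`**, `TwinSectionShift.mono`,
  **`twinSectionShift_half : TwinSectionShift (1/2)`**;
* **`rung_inclinedLamellar_twin_half`** — `rung_inclinedLamellar_twin` with the hypothesis discharged:
  every polyhedral set cut by parallel planes of ANY unit normal `n` into lamellae with pairwise
  co-axial frames (axis `m`) satisfies `6·2^{1/3}(√2·Vol)^{2/3} ≤ Fr + ½·sin∠(n,m)·Σ_f S_f`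
  (`S_f` = one-sided section bounds at the walls) — the crux's co-axial wall charge `c₁ = ½` on the
  nose, with room `½ − 1/√6 = 0.092` per unit `sin∠`.
WHAT THIS IS NOT: the identification `S_f = |wall_f|` and `ι_{W}`-bookkeeping turning the right-hand
side into the crux's `En` (routine exterior calculus, not done here); fans / multi-axis colonies; the
crux is not claimed. -/

noncomputable section

open scoped BigOperators InnerProductSpace ENNReal
open MeasureTheory Set

namespace Summit.Ventures.Crystal3D.Theorems

open Summit.Ventures.Crystal3D.Cruxes.TextureLiminf.TexShadow (E3)
open Literature.MathematicalPhysics.StatisticalMechanics (fccStacking barlowStacking IsHaggSeq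
  fccWulffBody isCompact_fccWulffBody barlowShell barlowShell_one_neg_one_eq mem_barlowShell_iff)
open Literature.Geometry.DiscreteGeometry (fccKissingPattern layerShell IsArrangedIn closePackingFrame
  scaledPattern two_smul_closePackingFrame_smul_intVec sqrt_two_inv_mul_sqrt_two uveCombo_mem_layerShell
  fcc_shellTable mem_signSet card_fccKissingPattern ncard_layerShell_le finite_layerShell layerSpacing
  closePackingFrame_apply closePackingFrameLin_apply_zero closePackingFrameLin_apply_one)

/-! ### An explicit cubic frame taking `(1,1,1)` to the stacking axis -/

/-- **Hales's close-packing frame as the cubic frame of the crux's lattice**: there is a linear isometry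
`L` with `{w ∈ Λ₀ : ‖w‖ = 1} = L(fccKissingPattern)` (as in `exists_linearIsometryEquiv_unitShell_eq`)
which moreover maps the cube diagonal `(1,1,1)` to a multiple of the stacking axis `e₂`. -/
theorem exists_cubicFrame_unitShell_eq :
    ∃ L : E3 ≃ₗᵢ[ℝ] E3,
      {w | w ∈ fccStacking 1 (Real.sqrt (2 / 3)) ∧ ‖w‖ = 1} = L '' (fccKissingPattern : Set E3) ∧
      ∃ c : ℝ, L (!₂[(1 : ℝ), 1, 1]) = c • EuclideanSpace.single (2 : Fin 3) (1 : ℝ) := by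
  have hσ : (1 : ℤ) = 1 ∨ (1 : ℤ) = -1 := Or.inl rfl
  have hσR : (1 : ℝ) = 1 ∨ (1 : ℝ) = -1 := Or.inl rfl
  set A := closePackingFrame (1 : ℝ) hσR with hAdef
  have hsub : (fun p => (2 : ℝ) • A p) '' (fccKissingPattern : Set E3) ⊆ layerShell (1 : ℝ) (-1) := by
    rintro _ ⟨p, hp, rfl⟩
    rw [Finset.mem_coe, fccKissingPattern, scaledPattern, Finset.mem_image] at hp
    obtain ⟨t, ht, rfl⟩ := hp
    dsimp only
    rw [hAdef, two_smul_closePackingFrame_smul_intVec, sqrt_two_inv_mul_sqrt_two, one_smul]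
    have h := uveCombo_mem_layerShell (fcc_shellTable 1 (mem_signSet hσ) t ht)
    push_cast at h ⊢
    exact h
  have himg : layerShell (1 : ℝ) (-1) = (fun p => (2 : ℝ) • A p) '' (fccKissingPattern : Set E3) :=
    (Set.eq_of_subset_of_ncard_le hsub (by
      rw [(show IsArrangedIn _ fccKissingPattern from ⟨A, rfl⟩).ncard_eq, card_fccKissingPattern]
      exact ncard_layerShell_le _ _) (finite_layerShell _ _)).symm
  let L : E3 ≃ₗᵢ[ℝ] E3 := A.toLinearIsometryEquiv rfl
  refine ⟨L, ?_, A (!₂[(1 : ℝ), 1, 1]) 2, ?_⟩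
  · have hshell : {w | w ∈ fccStacking 1 (Real.sqrt (2 / 3)) ∧ ‖w‖ = 1} = barlowShell 1 (-1) :=
      barlowShell_one_neg_one_eq.symm
    rw [hshell]
    ext v
    rw [mem_barlowShell_iff, himg]
    constructor
    · rintro ⟨p, hp, hpv⟩
      refine ⟨p, hp, ?_⟩
      have h2 := smul_right_injective E3 (two_ne_zero (α := ℝ)) hpv
      simpa [L] using h2
    · rintro ⟨p, hp, rfl⟩
      exact ⟨p, hp, by simp [L]⟩
  · have hLA : ∀ x : E3, L x = A x := fun x => rfl
    have hd0 : (!₂[(1 : ℝ), 1, 1] : E3) 0 = 1 := by simp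
    have hd1 : (!₂[(1 : ℝ), 1, 1] : E3) 1 = 1 := by simp
    have hd2 : (!₂[(1 : ℝ), 1, 1] : E3) 2 = 1 := by simp
    have h0 : A (!₂[(1 : ℝ), 1, 1]) 0 = 0 := by
      rw [hAdef, closePackingFrame_apply, closePackingFrameLin_apply_zero, hd0, hd1]; ring
    have h1 : A (!₂[(1 : ℝ), 1, 1]) 1 = 0 := by
      rw [hAdef, closePackingFrame_apply, closePackingFrameLin_apply_one, hd0, hd1, hd2]; ring
    ext i
    fin_cases i
    · simp [hLA, h0]
    · simp [hLA, h1]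
    · simp [hLA]

/-! ### Conjugating mirrors by isometries -/

/-- `T ∘ R_u = R_{T u} ∘ T` for a linear isometry `T`. -/
theorem map_reflection_orthogonal (T : E3 ≃ₗᵢ[ℝ] E3) (u x : E3) :
    T ((ℝ ∙ u)ᗮ.reflection x) = (ℝ ∙ T u)ᗮ.reflection (T x) := by
  rw [reflection_orthogonal_apply_div, reflection_orthogonal_apply_div, map_sub,
    LinearIsometryEquiv.map_smul, LinearIsometryEquiv.norm_map, LinearIsometryEquiv.inner_map_map]

/-- Image form: `R_{T u}(T S) = T(R_u S)`. -/
theorem reflection_image_image_eq_of_map (T : E3 ≃ₗᵢ[ℝ] E3) (u : E3) (S : Set E3) :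
    (ℝ ∙ T u)ᗮ.reflection '' (T '' S) = T '' ((ℝ ∙ u)ᗮ.reflection '' S) := by
  ext y
  simp only [mem_image]
  constructor
  · rintro ⟨_, ⟨x, hx, rfl⟩, rfl⟩
    exact ⟨_, ⟨x, hx, rfl⟩, map_reflection_orthogonal T u x⟩
  · rintro ⟨_, ⟨x, hx, rfl⟩, rfl⟩
    exact ⟨T x, ⟨x, hx, rfl⟩, (map_reflection_orthogonal T u x).symm⟩

/-- The mirror only depends on the line: `R_{a u} = R_u` for `a ≠ 0`. -/
theorem reflection_orthogonal_smul_apply {a : ℝ} (ha : a ≠ 0) (u x : E3) :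
    (ℝ ∙ (a • u))ᗮ.reflection x = (ℝ ∙ u)ᗮ.reflection x := by
  rw [reflection_orthogonal_apply_div, reflection_orthogonal_apply_div, real_inner_smul_left, norm_smul,
    mul_pow, smul_smul, Real.norm_eq_abs, sq_abs]
  by_cases hu : u = 0
  · rw [hu, smul_zero, smul_zero]
  · congr 1
    have hu' : ‖u‖ ≠ 0 := norm_ne_zero_iff.2 hu
    field_simp

/-! ### The twin section shift in the crux's vocabulary -/

/-- **The twin section shift of the crux's Wulff bodies**: for every co-axial frame pair (`Ax m A B`),
every unit normal `n` and every `t`,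
`|W(B) ∩ {⟪y, n⟫ < t}| ≤ |W(A) ∩ {⟪y, n⟫ < t + (1/√6)·√(1 − ⟪n, m⟫²)}|`. -/
theorem cruxWulffBody_twin_cdf_le {m : E3} {A B : E3 ≃ₗᵢ[ℝ] E3}
    (hAx : ∃ (L : E3 ≃ₗᵢ[ℝ] E3) (s₁ s₂ : E3) (σ σ' : ℤ → ℤ), IsHaggSeq σ ∧ IsHaggSeq σ' ∧
      L (EuclideanSpace.single (2 : Fin 3) (1 : ℝ)) = m ∧
      A '' fccStacking 1 (Real.sqrt (2 / 3)) ⊆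
        (fun q => L q + s₁) '' barlowStacking 1 (Real.sqrt (2 / 3)) σ ∧
      B '' fccStacking 1 (Real.sqrt (2 / 3)) ⊆
        (fun q => L q + s₂) '' barlowStacking 1 (Real.sqrt (2 / 3)) σ')
    (n : E3) (hn : ‖n‖ = 1) (t : ℝ) :
    volume ({y : E3 | ∀ ν : E3, ⟪y, ν⟫_ℝ ≤ Real.sqrt 2 / 4 *
        ∑ᶠ w ∈ {w | w ∈ fccStacking 1 (Real.sqrt (2 / 3)) ∧ ‖w‖ = 1}, |⟪w, B.symm ν⟫_ℝ|} ∩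
        {y : E3 | ⟪y, n⟫_ℝ < t}) ≤
      volume ({y : E3 | ∀ ν : E3, ⟪y, ν⟫_ℝ ≤ Real.sqrt 2 / 4 *
        ∑ᶠ w ∈ {w | w ∈ fccStacking 1 (Real.sqrt (2 / 3)) ∧ ‖w‖ = 1}, |⟪w, A.symm ν⟫_ℝ|} ∩
        {y : E3 | ⟪y, n⟫_ℝ < t + 1 / Real.sqrt 6 * Real.sqrt (1 - ⟪n, m⟫_ℝ ^ 2)}) := by
  have hδ0 : 0 ≤ 1 / Real.sqrt 6 * Real.sqrt (1 - ⟪n, m⟫_ℝ ^ 2) := by positivity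
  rcases cruxWulffBody_eq_or_eq_reflection_image hAx with hB | hB
  · -- equal bodies: monotonicity in the level
    rw [hB]
    exact measure_mono (inter_subset_inter_right _ fun y hy => lt_of_lt_of_le hy
      (le_add_of_nonneg_right hδ0))
  rw [hB]
  -- the self-clause of `Ax` and the frame of `W(A)`
  obtain ⟨L', s₁, -, σ, -, hσ, -, hL'm, h1, -⟩ := hAx
  have hm : ‖m‖ = 1 := by rw [← hL'm, LinearIsometryEquiv.norm_map, PiLp.norm_single, norm_one]
  obtain ⟨M, hWA, hMm⟩ := exists_frame_cruxWulffBody (m := m) (A := A)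
    ⟨L', s₁, s₁, σ, σ, hσ, hσ, hL'm, h1, h1⟩
  obtain ⟨L, hL, c, hLc⟩ := exists_cubicFrame_unitShell_eq
  have hW1 := cruxWulffBody_eq_image_fccWulffBody hL (LinearIsometryEquiv.refl ℝ E3)
  rw [LinearIsometryEquiv.trans_refl] at hW1
  rw [hW1, ← image_comp] at hWA
  -- `W(A) = T '' W_cubic` with `T = M ∘ L`, and `T (1,1,1) = ±c • m`
  set T : E3 ≃ₗᵢ[ℝ] E3 := L.trans M with hT
  have hWA' : {y : E3 | ∀ ν : E3, ⟪y, ν⟫_ℝ ≤ Real.sqrt 2 / 4 *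
      ∑ᶠ w ∈ {w | w ∈ fccStacking 1 (Real.sqrt (2 / 3)) ∧ ‖w‖ = 1}, |⟪w, A.symm ν⟫_ℝ|} =
      T '' fccWulffBody := by
    rw [hWA, hT, LinearIsometryEquiv.coe_trans]
  set d : E3 := !₂[(1 : ℝ), 1, 1] with hd
  obtain ⟨ε, hε, hTd⟩ : ∃ ε : ℝ, (ε = 1 ∨ ε = -1) ∧ T d = (ε * c) • m := by
    rcases hMm with h | h
    · exact ⟨1, Or.inl rfl, by rw [hT, LinearIsometryEquiv.coe_trans, Function.comp_apply, hLc,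
        LinearIsometryEquiv.map_smul, h, one_mul]⟩
    · exact ⟨-1, Or.inr rfl, by rw [hT, LinearIsometryEquiv.coe_trans, Function.comp_apply, hLc,
        LinearIsometryEquiv.map_smul, h, smul_neg, ← neg_smul, neg_one_mul]⟩
  have hd3 : ‖d‖ ^ 2 = 3 := norm_sq_cubic_vectors.1
  have hεc2 : (ε * c) ^ 2 = 3 := by
    have h1 : ‖T d‖ = ‖d‖ := LinearIsometryEquiv.norm_map T d
    rw [hTd, norm_smul, hm, mul_one, Real.norm_eq_abs] at h1
    rw [← sq_abs, h1, hd3]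
  have hεc : ε * c ≠ 0 := by
    intro h; rw [h] at hεc2; norm_num at hεc2
  -- the twin mirror in the cubic frame
  have hR : ⇑((ℝ ∙ m)ᗮ.reflection) = ⇑((ℝ ∙ T d)ᗮ.reflection) := by
    funext x
    rw [hTd, reflection_orthogonal_smul_apply hεc]
  rw [hWA', hR, reflection_image_image_eq_of_map T d fccWulffBody]
  -- transport both volumes through `T`
  have hRW : MeasurableSet ((ℝ ∙ d)ᗮ.reflection '' (fccWulffBody : Set E3)) :=
    (isCompact_fccWulffBody.image (ℝ ∙ d)ᗮ.reflection.continuous).measurableSet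
  have hWm : MeasurableSet (fccWulffBody : Set E3) := isCompact_fccWulffBody.measurableSet
  rw [volume_image_inter_halfSpace T hRW n t, volume_image_inter_halfSpace T hWm n]
  -- the cubic theorem for the pulled-back normal
  have hn' : ‖T.symm n‖ = 1 := by rw [LinearIsometryEquiv.norm_map, hn]
  have hinner : ⟪T.symm n, d⟫_ℝ ^ 2 / 3 = ⟪n, m⟫_ℝ ^ 2 := by
    have h1 : ⟪T.symm n, d⟫_ℝ = ⟪n, T d⟫_ℝ := by
      rw [← T.inner_map_map (T.symm n) d, T.apply_symm_apply]
    rw [h1, hTd, real_inner_smul_right, mul_pow, hεc2]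
    ring
  have h := fccWulffBody_twin_cdf_le (T.symm n) hn' t
  rw [hinner] at h
  exact h

end Summit.Ventures.Crystal3D.Theorems

namespace Summit.Ventures.Crystal3D.Cruxes.PolycrystalWulffBound.PolyDensity

open Summit.Ventures.Crystal3D.Theorems

/-- **`TwinSectionShift (1/√6)` holds** — poly-p2 g8's computational hypothesis for inclined lamellar
twins is a theorem, at the numerically sharp constant `1/√6`. -/
theorem twinSectionShift_inv_sqrt_six : TwinSectionShift (1 / Real.sqrt 6) := by
  intro m A B hAB n hn t
  exact cruxWulffBody_twin_cdf_le hAB n hn t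

/-- `TwinSectionShift` is monotone in the constant. -/
theorem TwinSectionShift.mono {c c' : ℝ} (hcc' : c ≤ c') (hc : TwinSectionShift c) : TwinSectionShift c' := by
  intro m A B hAB n hn t
  refine le_trans (hc m A B hAB n hn t) (measure_mono (Set.inter_subset_inter_right _ fun y hy => ?_))
  have hy' : ⟪y, n⟫_ℝ < t + c * Real.sqrt (1 - ⟪n, m⟫_ℝ ^ 2) := hy
  have h0 : 0 ≤ Real.sqrt (1 - ⟪n, m⟫_ℝ ^ 2) := Real.sqrt_nonneg _
  have h1 : c * Real.sqrt (1 - ⟪n, m⟫_ℝ ^ 2) ≤ c' * Real.sqrt (1 - ⟪n, m⟫_ℝ ^ 2) :=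
    mul_le_mul_of_nonneg_right hcc' h0
  show ⟪y, n⟫_ℝ < t + c' * Real.sqrt (1 - ⟪n, m⟫_ℝ ^ 2)
  linarith

/-- **`TwinSectionShift (1/2)` holds** — the crux's co-axial wall charge `c₁ = ½` is admissible
(`1/√6 ≤ 1/2`). -/
theorem twinSectionShift_half : TwinSectionShift (1 / 2) := by
  refine TwinSectionShift.mono ?_ twinSectionShift_inv_sqrt_six
  have h4 : Real.sqrt 4 = 2 := by
    rw [show (4 : ℝ) = 2 ^ 2 by norm_num, Real.sqrt_sq (by norm_num : (0 : ℝ) ≤ 2)]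
  have h2 : (2 : ℝ) ≤ Real.sqrt 6 := by
    rw [← h4]
    exact Real.sqrt_le_sqrt (by norm_num)
  exact one_div_le_one_div_of_le (by norm_num) h2

/-- **Rung `rung_inclinedLamellar_twin` UNCONDITIONALLY at the crux's charge `½`**: a polyhedral set cut
by parallel planes of any unit normal `n` into lamellae with pairwise co-axial frames (axis `m`)
satisfies `6·2^{1/3}(√2·Vol)^{2/3} ≤ Fr + ½·sin∠(n,m)·Σ_f S_f` (`S_f` one-sided section bounds at the
walls). -/
theorem rung_inclinedLamellar_twin_half :

    let Λ : Set (EuclideanSpace ℝ (Fin 3)) := Literature.MathematicalPhysics.StatisticalMechanics.fccStacking 1 (Real.sqrt (2 / 3)); let Brl : (ℤ → ℤ) → Set (EuclideanSpace ℝ (Fin 3)) := Literature.MathematicalPhysics.StatisticalMechanics.barlowStacking 1 (Real.sqrt (2 / 3)); let Ax : EuclideanSpace ℝ (Fin 3) → (EuclideanSpace ℝ (Fin 3) ≃ₗᵢ[ℝ] EuclideanSpace ℝ (Fin 3)) → (EuclideanSpace ℝ (Fin 3) ≃ₗᵢ[ℝ] EuclideanSpace ℝ (Fin 3)) → Prop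 := fun m A B => ∃ (L : EuclideanSpace ℝ (Fin 3) ≃ₗᵢ[ℝ] EuclideanSpace ℝ (Fin 3)) (s₁ s₂ : EuclideanSpace ℝ (Fin 3)) (σ σ' : ℤ → ℤ), Literature.MathematicalPhysics.StatisticalMechanics.IsHaggSeq σ ∧ Literature.MathematicalPhysics.StatisticalMechanics.IsHaggSeq σ' ∧ L (EuclideanSpace.single (2 : Fin 3) (1 : ℝ)) = m ∧ A '' Λ ⊆ (fun q => L q + s₁) '' Brl σ ∧ B '' Λ ⊆ (fun q => L q + s₂) '' Brl σ'; let Φ : EuclideanSpace ℝ (Fin 3) → ℝ := fun ν => Real.sqrt 2 / 4 * ∑ᶠ w ∈ {w ∈ Λ | ‖w‖ = 1}, |⟪w, ν⟫_ℝ|; let Per : Set (EuclideanSpace ℝ (Fin 3)) → Set (EuclideanSpace ℝ (Fin 3)) → ℝ := fun K S => (⨆ (ξ : EuclideanSpace ℝ (Fin 3) → EuclideanSpace ℝ (Fin 3)) (_ : ContDiff ℝ 1 ξ ∧ HasCompactSupport ξ ∧ ∀ z, ξ z ∈ K), ENNReal.ofReal (∫ z in S, Literature.MathematicalPhysics.StatisticalMechanics.fieldDivergence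 ξ z)).toReal; let ι : Set (EuclideanSpace ℝ (Fin 3)) → Set (EuclideanSpace ℝ (Fin 3)) → Set (EuclideanSpace ℝ (Fin 3)) → ℝ := fun K S₁ S₂ => (Per K S₁ + Per K S₂ - Per K (S₁ ∪ S₂)) / 2; let W : (EuclideanSpace ℝ (Fin 3) ≃ₗᵢ[ℝ] EuclideanSpace ℝ (Fin 3)) → Set (EuclideanSpace ℝ (Fin 3)) := fun A => {y | ∀ ν : EuclideanSpace ℝ (Fin 3), ⟪y, ν⟫_ℝ ≤ Φ (A.symm ν)}; let Vol : (n : ℕ) → (Fin n → Set (EuclideanSpace ℝ (Fin 3))) → ℝ := fun n G => (volume (⋃ f : Fin n, G f)).toReal; let Poly : Set (EuclideanSpace ℝ (Fin 3)) → Prop := fun S => ∃ (k : ℕ) (H : Fin k → Finset ((EuclideanSpace ℝ (Fin 3)) × ℝ)), S = ⋃ i, ⋂ p ∈ H i, {x | ⟪p.1, x⟫_ℝ < p.2}; let Fr : (n : ℕ) → (Fin n → Set (EuclideanSpace ℝ (Fin 3))) → (Fin n → (EuclideanSpace ℝ (Fin 3) ≃ₗᵢ[ℝ] EuclideanSpace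 ℝ (Fin 3))) → ℝ := fun n G A => ∑ f : Fin n, Per (W (A f)) (G f) - ∑ f, ∑ g, (if f = g then 0 else ι (W (A f)) (G f) (G g)); ∀ (E : Set (EuclideanSpace ℝ (Fin 3))), Poly E → volume E < ⊤ → ∀ (m n : EuclideanSpace ℝ (Fin 3)), ‖n‖ = 1 → ∀ (k : ℕ) (a : Fin (k + 1) → ℝ), StrictMono a → ∀ (A : Fin k → (EuclideanSpace ℝ (Fin 3) ≃ₗᵢ[ℝ] EuclideanSpace ℝ (Fin 3))) (S : Fin k → ℝ), (∀ f g, Ax m (A f) (A g)) → (∀ f, 0 ≤ S f) → (∀ f (h : ℝ), 0 < h → volume (E ∩ {x | a f.succ - h ≤ ⟪x, n⟫_ℝ ∧ ⟪x, n⟫_ℝ < a f.succ}) ≤ ENNReal.ofReal (h * S f)) → 6 * (2 : ℝ) ^ ((1 : ℝ) / 3) * (Real.sqrt 2 * Vol k (fun f => E ∩ {x | a f.castSucc < ⟪x, n⟫_ℝ ∧ ⟪x, n⟫_ℝ < a f.succ})) ^ ((2 : ℝ) / 3) ≤ Fr k (fun f => E ∩ {x | a f.castSucc < ⟪x, n⟫_ℝ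 ∧ ⟪x, n⟫_ℝ < a f.succ}) A + 1 / 2 * Real.sqrt (1 - ⟪n, m⟫_ℝ ^ 2) * ∑ f, S f :=
  rung_inclinedLamellar_twin (by norm_num) twinSectionShift_half

/-- **Local form** (`rung_inclinedLamellar_of_cdfShift_local` with the shift discharged by
`twinSectionShift_half`): the one-sided section bounds `|E ∩ {a_{f+1} − h ≤ ⟪x,n⟫ < a_{f+1}}| ≤ h·S_f`
are required only for `h < h₀`, so `S_f` may be the wall's section area `+ ε` and the top level may carry
`S = 0`. -/
theorem rung_inclinedLamellar_twin_local_half :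

    let Λ : Set (EuclideanSpace ℝ (Fin 3)) := Literature.MathematicalPhysics.StatisticalMechanics.fccStacking 1 (Real.sqrt (2 / 3)); let Brl : (ℤ → ℤ) → Set (EuclideanSpace ℝ (Fin 3)) := Literature.MathematicalPhysics.StatisticalMechanics.barlowStacking 1 (Real.sqrt (2 / 3)); let Ax : EuclideanSpace ℝ (Fin 3) → (EuclideanSpace ℝ (Fin 3) ≃ₗᵢ[ℝ] EuclideanSpace ℝ (Fin 3)) → (EuclideanSpace ℝ (Fin 3) ≃ₗᵢ[ℝ] EuclideanSpace ℝ (Fin 3)) → Prop := fun m A B => ∃ (L : EuclideanSpace ℝ (Fin 3) ≃ₗᵢ[ℝ] EuclideanSpace ℝ (Fin 3)) (s₁ s₂ : EuclideanSpace ℝ (Fin 3)) (σ σ' : ℤ → ℤ), Literature.MathematicalPhysics.StatisticalMechanics.IsHaggSeq σ ∧ Literature.MathematicalPhysics.StatisticalMechanics.IsHaggSeq σ' ∧ L (EuclideanSpace.single (2 : Fin 3) (1 : ℝ)) = m ∧ A '' Λ ⊆ (fun q => L q + s₁) '' Brl σ ∧ B '' Λ ⊆ (fun q => L q + s₂) ''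 Brl σ'; let Φ : EuclideanSpace ℝ (Fin 3) → ℝ := fun ν => Real.sqrt 2 / 4 * ∑ᶠ w ∈ {w ∈ Λ | ‖w‖ = 1}, |⟪w, ν⟫_ℝ|; let Per : Set (EuclideanSpace ℝ (Fin 3)) → Set (EuclideanSpace ℝ (Fin 3)) → ℝ := fun K S => (⨆ (ξ : EuclideanSpace ℝ (Fin 3) → EuclideanSpace ℝ (Fin 3)) (_ : ContDiff ℝ 1 ξ ∧ HasCompactSupport ξ ∧ ∀ z, ξ z ∈ K), ENNReal.ofReal (∫ z in S, Literature.MathematicalPhysics.StatisticalMechanics.fieldDivergence ξ z)).toReal; let ι : Set (EuclideanSpace ℝ (Fin 3)) → Set (EuclideanSpace ℝ (Fin 3)) → Set (EuclideanSpace ℝ (Fin 3)) → ℝ := fun K S₁ S₂ => (Per K S₁ + Per K S₂ - Per K (S₁ ∪ S₂)) / 2; let W : (EuclideanSpace ℝ (Fin 3) ≃ₗᵢ[ℝ] EuclideanSpace ℝ (Fin 3)) → Set (EuclideanSpace ℝ (Fin 3)) := fun A => {y | ∀ ν : EuclideanSpace ℝ (Fin 3), ⟪y, ν⟫_ℝ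 ≤ Φ (A.symm ν)}; let Vol : (n : ℕ) → (Fin n → Set (EuclideanSpace ℝ (Fin 3))) → ℝ := fun n G => (volume (⋃ f : Fin n, G f)).toReal; let Poly : Set (EuclideanSpace ℝ (Fin 3)) → Prop := fun S => ∃ (k : ℕ) (H : Fin k → Finset ((EuclideanSpace ℝ (Fin 3)) × ℝ)), S = ⋃ i, ⋂ p ∈ H i, {x | ⟪p.1, x⟫_ℝ < p.2}; let Fr : (n : ℕ) → (Fin n → Set (EuclideanSpace ℝ (Fin 3))) → (Fin n → (EuclideanSpace ℝ (Fin 3) ≃ₗᵢ[ℝ] EuclideanSpace ℝ (Fin 3))) → ℝ := fun n G A => ∑ f : Fin n, Per (W (A f)) (G f) - ∑ f, ∑ g, (if f = g then 0 else ι (W (A f)) (G f) (G g)); ∀ (E : Set (EuclideanSpace ℝ (Fin 3))), Poly E → volume E < ⊤ → ∀ (m n : EuclideanSpace ℝ (Fin 3)), ‖n‖ = 1 → ∀ (k : ℕ) (a : Fin (k + 1) → ℝ), StrictMono a → ∀ (A : Fin k → (EuclideanSpace ℝ (Fin 3) ≃ₗᵢ[ℝ] EuclideanSpace ℝ (Fin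 3))) (S : Fin k → ℝ), (∀ f g, Ax m (A f) (A g)) → (∀ f, 0 ≤ S f) → ∀ (h₀ : ℝ), 0 < h₀ → (∀ f (h : ℝ), 0 < h → h < h₀ → volume (E ∩ {x | a f.succ - h ≤ ⟪x, n⟫_ℝ ∧ ⟪x, n⟫_ℝ < a f.succ}) ≤ ENNReal.ofReal (h * S f)) → 6 * (2 : ℝ) ^ ((1 : ℝ) / 3) * (Real.sqrt 2 * Vol k (fun f => E ∩ {x | a f.castSucc < ⟪x, n⟫_ℝ ∧ ⟪x, n⟫_ℝ < a f.succ})) ^ ((2 : ℝ) / 3) ≤ Fr k (fun f => E ∩ {x | a f.castSucc < ⟪x, n⟫_ℝ ∧ ⟪x, n⟫_ℝ < a f.succ}) A + 1 / 2 * Real.sqrt (1 - ⟪n, m⟫_ℝ ^ 2) * ∑ f, S f := by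
  intro Λ Brl Ax Φ Per ι W Vol Poly Fr E hE hEv m n hn k a ha A S hAx hS0 h₀ hh₀ hS
  have hδ : 0 ≤ 1 / 2 * Real.sqrt (1 - ⟪n, m⟫_ℝ ^ 2) := by positivity
  exact rung_inclinedLamellar_of_cdfShift_local E hE hEv n hn k a ha A (1 / 2 * Real.sqrt (1 - ⟪n, m⟫_ℝ ^ 2))
    S hδ (fun f g _ t => twinSectionShift_half m (A f) (A g) (hAx f g) n hn t) hS0 h₀ hh₀ hS

end Summit.Ventures.Crystal3D.Cruxes.PolycrystalWulffBound.PolyDensity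

end
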